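import Summits.QuantumFields.YangMills.Theorems.FluctuationComparisonRegPrIntLS2BetaKeyLemmaSkeleton
import Summits.QuantumFields.YangMills.Theorems.FluctuationComparisonRegPrIntLS2BetaTentKernelTorus
import Summits.QuantumFields.YangMills.Theorems.FluctuationComparisonRegPrIntLS2BetaNeighbourhoodKernelTorus
import Summits.QuantumFields.YangMills.Theorems.FluctuationComparisonRegPrIntLS2BetaThresholdSum
import HarnessLib

/-!
# S2β · `hFlat` road, UV3-NODE §57.8 (C) ∕ §64.2 ∕ §65.3 — «F1-DOCK»: THE KEY LEMMA ON THE T³ RECORD ⟸ THE ONE-LEVEL (C)-STEP, GUARDED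
# (`hF1` of ✓px17 `…HFlatOfFeeders.relLetter_of_feeders` VERBATIM from a per-level step inequality on the levels `t < K − J` of a good history)

Cell `ym3-torus` (YM ladder rung R3 = continuum `SU(2)` Yang–Mills on the three-torus — a RUNG: NOT d = 4, NOT infinite volume, NOT a mass gap,
NOT Clay).  Width seat «width 13» `ym3-torus-px13` (gen 23), FREE px helper on crux `stmt-QuantumFields-20520`
(`Theses.UnitScaleTilt.FluctuationComparisonRegPrIntL`); `--kind proof --supports stmt-QuantumFields-20520 --as helper`, count-neutral, DEFINITION-FREE
(0 `def`, 0 `instance`, 0 `notation`, 0 `sorry`, default heartbeats); finite sums + the product recursion over four landed bricks.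

WHY.  ✓px8 g21 G11 `…KeyLemmaSkeleton.keyLemma_tower(_sqrtL)` turns a POINTWISE level inequality `f_{t+1} ≤ (1+θ_t)·T_t f_t + j_t` (positive kernel with row
sums `≤ R_t`, column sums `≤ C_t`; junk `‖j_t‖₂ ≤ ε_t‖f_t‖₂`) into `‖f_t‖₂ ≤ (√L)^t·exp(Σ(θ + ε∕√L))·‖f_0‖₂` — but with `hstep`∕`hj` quantified over ALL
`t : ℕ`.  On the T³ record the (C)-STEP (px10 g22, `…OneLevelStep`, typing) holds at the levels `t < K − J` of a GOOD HISTORY only (`PlaqSmall θBal(K−t)`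
of the `t`-fold (0.4) average, standing range `t + 1 ≤ F.m + K`), and the consumer ✓px17 g19 `…HFlatOfFeeders.relLetter_of_feeders` wants
    `hF1 : ∀ t ≤ K − J, √(Σ_p dist1((M^tU)(∂p))²) ≤ Kc · √L^t · √(Σ_p dist1(U(∂p))²)`
with ONE constant `Kc` chosen before `(b₀, p₀)` (the `∃ C` of ✓px17 `hFlat_of_letter`'s `HL`).  THIS FILE is the guarded tower + the threshold sum in between:
* §1 `le_prod_mul_of_forall_lt`, ★`keyLemma_tower_upto` (G11's tower with every level hypothesis for `t < m` only, conclusion for `t ≤ m`; proof = ✓`keyLemma_level`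
  per level), `keyLemma_tower_upto_sqrtL` (the `√L` reading with ONE depth-`m` constant `exp(Σ_{i<m}(θ_i + ε_i∕√L))`).
* §2 ★★ `keyLemma_torus_of_step` — ANY `Params` with `d = 3`, ANY gauge group, ANY small-loop average `ℰ`, ANY thresholds `θ_t ≥ 0`: the pointwise step
  `dist1((M^{t+1}U)(∂Q)) ≤ (1 + C₁θ_t)·Σ_p 𝐊(Q,p)·dist1((M^tU)(∂p)) + C₂θ_t·Σ_{q ∈ N(Q.src)} dist1((M^tU)(∂q))` for `t < m` — `𝐊` = ✓px12 g23 `…TentKernelTorus`'s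
  kernel at `z = Q.src`, plane `(Q.μ, Q.ν)` VERBATIM ((R) `tentKernel_row` = `L²`, (C) `tentKernel_col_three` ≤ `L⁻¹`, so `R·C = L`; the column sum over coarse
  PLAQUETTES reduces to px12's sum over coarse SITES since the kernel vanishes off the plane of `p`), `N(·)` = ✓px10 g22 `…NeighbourhoodKernelTorus`'s `3^d`-block
  neighbourhood VERBATIM (`sqrt_sum_sq_le_of_le_nbhd_sum`: `ε_t = C₂θ_t·√(N_row·N_col)`) — gives
  `∀ t ≤ m, ‖dist1 (M^tU)(∂·)‖₂ ≤ √L^t · exp((C₁ + C₂√(N_rowN_col)∕√L)·Σ_{i<m} θ_i) · ‖dist1 U(∂·)‖₂`.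
* §3 ★★★ `keyLemma_record_of_step` — the T³ record (`F.P K`, `SU(2)`, `ℰp`, `θ_t := θBal F.L γ b₀ p₀ (K − t)`, `m := K − J`): `hF1`'s two sides VERBATIM with the
  explicit `Kc := exp((C₁ + C₂√(N_rowN_col)∕√L)·Σ_{i<K−J} θBal(K−i))`.
* §4 ★★★ `keyLemma_record_uniform` — ✓`…ThresholdSum.thresholdSum_small` makes the exponent `≤ 1` for `γ ≤ γ₁(L, b₀, p₀, C₁, C₂, a₀)`: for every good history
  `U ∈ histGood K J` whose levels obey the (C)-STEP (hypothesis offered WITH the premises `PlaqSmall θBal(K−t) (M^tU)` and `θBal(K−t) ≤ a₀` the step's supplier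
  needs), `hF1` holds with `Kc := exp 1` — a constant before `(b₀, p₀, γ)`, as `HL` requires.

SO, BY KERNEL: `hF1` of ✓`relLetter_of_feeders` ⟸ ONE displayed per-level hypothesis in the (C)-STEP's announced output shape (px10 g22 STATUS 08:15:07Z ∕ 08:27:21Z:
`(1 + C₁(d,L)·θ)·Σ_p K Q p·dist1 + C₂(d,L)·θ·Σ_{q∈N(Q)} dist1` under `PlaqSmall θ`); when `…OneLevelStep` lands, F1 on the record is `fun t ht hsm hθ Q => oneLevelStep …`.
Nothing here bounds a plaquette: the step hypothesis carries all the analysis.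

HONEST SCOPE.  Finite sums, Cauchy–Schwarz (through ✓`keyLemma_level`), the product recursion, a geometric threshold sum; nothing of Bałaban's analysis is asserted
or proved ([Balaban1985Averaging] (19) p.21 is the printed locus of the one-step plaquette bookkeeping, [Balaban1985UV3] (3), (7) pp.256–257 of the thresholds);
the (C)-STEP, (H), `hFlat`, TUBE-REG∘, GAP♯∘ (`stub_uniformFibreGapOrbit`), EXW∘, DET-REP-B, S2β, crux 20520, 19936, 19200 and `YM3TorusSU2` are NOT proved; no
registered stub is closed; rung R3 = SU(2) YM₃ on T³ at fixed lattice data — NOT d = 4, NOT infinite volume, NOT a mass gap, NOT Clay; the Yang–Mills mass gap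
is NOT proved.  References: T. Bałaban, CMP **98** (1985) 17–51 [Balaban1985Averaging]; CMP **102** (1985) 255–275 [Balaban1985UV3]; CMP **99** (1985) 75–102
[Balaban1985RegularSpaces].
-/

set_option autoImplicit false

noncomputable section

open Finset
open scoped BigOperators

namespace Summit.QuantumFields.YangMills.Theorems.FluctuationComparisonRegPrIntLS2BetaKeyLemmaRecord

open Literature.MathematicalPhysics.QuantumFieldTheory.Balaban1983to89
open T4Continuum T3ContinuumYM3Torus T3UnitScaleTilt BlockAveraging
open T3UnitLawDensityEML (ℰp)
open B10Eq47AxialChi (shiftN)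
open Summit.QuantumFields.YangMills.Theorems.FluctuationComparisonRegPrIntLS2BetaKeyLemmaSkeleton (keyLemma_level)
open Summit.QuantumFields.YangMills.Theorems.FluctuationComparisonRegPrIntLS2BetaTentKernelTorus
  (tentKernel_row tentKernel_col_three tentKernel_nonneg card_corners_eq_zero)
open Summit.QuantumFields.YangMills.Theorems.FluctuationComparisonRegPrIntLS2BetaNeighbourhoodKernelTorus (sqrt_sum_sq_le_of_le_nbhd_sum)
open Summit.QuantumFields.YangMills.Theorems.FluctuationComparisonRegPrIntLS2BetaThresholdSum (thresholdSum_small)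

/-! ## §1 The guarded tower (level hypotheses for `t < m` only, conclusion for `t ≤ m`) -/

/-- Guarded product recursion: `0 ≤ q i` and `a (i+1) ≤ q i · a i` for `i < m` give `a t ≤ (Π_{i<t} q i) · a 0` for every `t ≤ m`. [folklore] -/
theorem le_prod_mul_of_forall_lt (a q : ℕ → ℝ) (m : ℕ) (hq : ∀ i, i < m → 0 ≤ q i)
    (h : ∀ i, i < m → a (i + 1) ≤ q i * a i) : ∀ t, t ≤ m → a t ≤ (∏ i ∈ range t, q i) * a 0 := by
  intro t
  induction t with
  | zero => intro _; simp
  | succ t ih =>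
    intro ht
    have ht' : t < m := Nat.lt_of_succ_le ht
    calc a (t + 1) ≤ q t * a t := h t ht'
      _ ≤ q t * ((∏ i ∈ range t, q i) * a 0) := mul_le_mul_of_nonneg_left (ih ht'.le) (hq t ht')
      _ = (∏ i ∈ range (t + 1), q i) * a 0 := by rw [Finset.prod_range_succ]; ring

/-- ★ **THE KEY LEMMA SKELETON, GUARDED EDITION**: ✓`keyLemma_tower` of px8 g21's G11 with every level hypothesis (`K t ≥ 0`, row sums `≤ R t`,
column sums `≤ C t`, `0 ≤ θ t`, `0 ≤ ε t`, the pointwise step and the junk budget) assumed for the levels `t < m` ONLY, and the conclusion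
`‖f t‖₂ ≤ (Π_{i<t}((1+θ i)√(R i·C i) + ε i))·‖f 0‖₂` for every `t ≤ m` — the shape a finite renormalisation history `t = 0, …, m = K − J` supplies.
[cite: Balaban1985RegularSpaces, §1; Balaban1984PropagatorsII, §1] -/
theorem keyLemma_tower_upto (α : ℕ → Type*) [∀ t, Fintype (α t)] (m : ℕ) (f : (t : ℕ) → α t → ℝ) (hf : ∀ t a, 0 ≤ f t a)
    (K : (t : ℕ) → α (t + 1) → α t → ℝ) (hK : ∀ t, t < m → ∀ a b, 0 ≤ K t a b) (R C θ ε : ℕ → ℝ) (hR : ∀ t, t < m → 0 ≤ R t)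
    (hrow : ∀ t, t < m → ∀ a, ∑ b, K t a b ≤ R t) (hcol : ∀ t, t < m → ∀ b, ∑ a, K t a b ≤ C t)
    (hθ : ∀ t, t < m → 0 ≤ θ t) (hε : ∀ t, t < m → 0 ≤ ε t)
    (j : (t : ℕ) → α (t + 1) → ℝ)
    (hstep : ∀ t, t < m → ∀ a, f (t + 1) a ≤ (1 + θ t) * ∑ b, K t a b * f t b + j t a)
    (hj : ∀ t, t < m → √(∑ a, j t a ^ 2) ≤ ε t * √(∑ b, f t b ^ 2)) :
    ∀ t, t ≤ m → √(∑ a, f t a ^ 2) ≤ (∏ i ∈ range t, ((1 + θ i) * √(R i * C i) + ε i)) * √(∑ b, f 0 b ^ 2) := by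
  refine le_prod_mul_of_forall_lt (fun t => √(∑ a, f t a ^ 2)) (fun i => (1 + θ i) * √(R i * C i) + ε i) m
    (fun i hi => by have := hθ i hi; have := hε i hi; positivity) (fun i hi => ?_)
  exact keyLemma_level (K i) (hK i hi) (hR i hi) (hrow i hi) (hcol i hi) (f i) (f (i + 1)) (j i) (hf (i + 1)) (hθ i hi)
    (hstep i hi) (hj i hi)

/-- The `√L` reading of the guarded tower: if `R t·C t = L` (`1 ≤ L`) for `t < m` then for every `t ≤ m`
`‖f t‖₂ ≤ (√L)^t · exp(Σ_{i<m}(θ i + ε i∕√L)) · ‖f 0‖₂` — ONE depth-`m` constant serving every level `t ≤ m`. [folklore] -/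
theorem keyLemma_tower_upto_sqrtL (α : ℕ → Type*) [∀ t, Fintype (α t)] (m : ℕ) (f : (t : ℕ) → α t → ℝ) (hf : ∀ t a, 0 ≤ f t a)
    (K : (t : ℕ) → α (t + 1) → α t → ℝ) (hK : ∀ t, t < m → ∀ a b, 0 ≤ K t a b) {L : ℝ} (hL : 1 ≤ L) (R C θ ε : ℕ → ℝ)
    (hR : ∀ t, t < m → 0 ≤ R t) (hRC : ∀ t, t < m → R t * C t = L)
    (hrow : ∀ t, t < m → ∀ a, ∑ b, K t a b ≤ R t) (hcol : ∀ t, t < m → ∀ b, ∑ a, K t a b ≤ C t)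
    (hθ : ∀ t, t < m → 0 ≤ θ t) (hε : ∀ t, t < m → 0 ≤ ε t)
    (j : (t : ℕ) → α (t + 1) → ℝ)
    (hstep : ∀ t, t < m → ∀ a, f (t + 1) a ≤ (1 + θ t) * ∑ b, K t a b * f t b + j t a)
    (hj : ∀ t, t < m → √(∑ a, j t a ^ 2) ≤ ε t * √(∑ b, f t b ^ 2)) :
    ∀ t, t ≤ m → √(∑ a, f t a ^ 2) ≤
      Real.sqrt L ^ t * Real.exp (∑ i ∈ range m, (θ i + ε i / Real.sqrt L)) * √(∑ b, f 0 b ^ 2) := by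
  intro t ht
  have h := keyLemma_tower_upto α m f hf K hK R C θ ε hR hrow hcol hθ hε j hstep hj t ht
  refine h.trans (mul_le_mul_of_nonneg_right ?_ (Real.sqrt_nonneg _))
  have hsL : 1 ≤ Real.sqrt L := by rw [← Real.sqrt_one]; exact Real.sqrt_le_sqrt hL
  have hsL0 : 0 < Real.sqrt L := by linarith
  -- each factor: `(1+θ)√L + ε = √L·(1 + (θ + ε/√L)) ≤ √L·exp(θ + ε/√L)`
  have hfac : ∀ i, i < m → (1 + θ i) * √(R i * C i) + ε i ≤ Real.sqrt L * Real.exp (θ i + ε i / Real.sqrt L) :=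
    fun i hi => by
    rw [hRC i hi]
    have e : (1 + θ i) * Real.sqrt L + ε i = Real.sqrt L * (1 + (θ i + ε i / Real.sqrt L)) := by
      field_simp
      ring
    rw [e]
    exact mul_le_mul_of_nonneg_left (by linarith [Real.add_one_le_exp (θ i + ε i / Real.sqrt L)]) hsL0.le
  -- the partial sum `Σ_{i<t}` is dominated by the full sum `Σ_{i<m}` (nonnegative terms)
  have hsum : ∑ i ∈ range t, (θ i + ε i / Real.sqrt L) ≤ ∑ i ∈ range m, (θ i + ε i / Real.sqrt L) :=
    Finset.sum_le_sum_of_subset_of_nonneg (Finset.range_subset_range.mpr ht) fun i hi _ => by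
      have him : i < m := Finset.mem_range.mp hi
      have := hθ i him; have := hε i him; positivity
  calc ∏ i ∈ range t, ((1 + θ i) * √(R i * C i) + ε i) ≤ ∏ i ∈ range t, Real.sqrt L * Real.exp (θ i + ε i / Real.sqrt L) :=
        Finset.prod_le_prod (fun i hi => by
            have him : i < m := lt_of_lt_of_le (Finset.mem_range.mp hi) ht
            have := hθ i him; have := hε i him; positivity)
          fun i hi => hfac i (lt_of_lt_of_le (Finset.mem_range.mp hi) ht)
    _ = Real.sqrt L ^ t * Real.exp (∑ i ∈ range t, (θ i + ε i / Real.sqrt L)) := by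
        rw [Finset.prod_mul_distrib, Finset.prod_const, Finset.card_range, Real.exp_sum]
    _ ≤ Real.sqrt L ^ t * Real.exp (∑ i ∈ range m, (θ i + ε i / Real.sqrt L)) :=
        mul_le_mul_of_nonneg_left (Real.exp_le_exp.mpr hsum) (pow_nonneg hsL0.le _)

/-! ## §2 The torus: ANY `d = 3` parameters, ANY gauge group, ANY small-loop average, ANY nonnegative thresholds -/

section Torus

variable {P : Params} {G : Type*} [GaugeGroup G]

/-- The tent kernel's COLUMN sum over coarse PLAQUETTES `Q` (fixed fine `p`) is px12 g23's column sum over coarse SITES in the plane of `p`: the kernel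
vanishes unless `(Q.μ, Q.ν) = (p.μ, p.ν)`. Hence `≤ L⁻¹` in `d = 3` (✓`tentKernel_col_three`). [cite: Balaban1985Averaging, (19) p.21] -/
theorem tentKernel_colPlaq_three {t : ℕ} (hd : P.d = 3) (ht : t + 1 ≤ P.m + P.K) (p : Plaq P t) :
    ∑ Q : Plaq P (t + 1), ((P.L : ℝ) ^ P.d)⁻¹ * (((block Q.src).filter (fun x : Site P t => p.μ = Q.μ ∧ p.ν = Q.ν ∧
      ∃ a ∈ range P.L, ∃ b ∈ range P.L, p.src = shiftN (shiftN x Q.μ a) Q.ν b)).card : ℝ) ≤ (P.L : ℝ)⁻¹ := by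
  classical
  -- restrict to the plane of `p`: off it the filter is empty
  have hzero : ∀ Q ∈ (Finset.univ : Finset (Plaq P (t + 1))), Q ∉ Finset.univ.filter (fun Q : Plaq P (t + 1) => Q.μ = p.μ ∧ Q.ν = p.ν) →
      ((P.L : ℝ) ^ P.d)⁻¹ * (((block Q.src).filter (fun x : Site P t => p.μ = Q.μ ∧ p.ν = Q.ν ∧
        ∃ a ∈ range P.L, ∃ b ∈ range P.L, p.src = shiftN (shiftN x Q.μ a) Q.ν b)).card : ℝ) = 0 := by
    intro Q _ hQ
    have hQ' : ¬(p.μ = Q.μ ∧ p.ν = Q.ν) := by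
      intro h; exact hQ (Finset.mem_filter.mpr ⟨Finset.mem_univ _, h.1.symm, h.2.symm⟩)
    rw [card_corners_eq_zero p hQ' (block Q.src), Nat.cast_zero, mul_zero]
  rw [← Finset.sum_subset (Finset.filter_subset _ _) hzero]
  -- the plane of `p` among the coarse plaquettes is the image of the coarse sites
  have himg : Finset.univ.filter (fun Q : Plaq P (t + 1) => Q.μ = p.μ ∧ Q.ν = p.ν) =
      Finset.univ.image (fun z : Site P (t + 1) => (⟨z, p.μ, p.ν, p.hμν⟩ : Plaq P (t + 1))) := by
    ext Q
    simp only [Finset.mem_filter, Finset.mem_univ, true_and, Finset.mem_image]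
    constructor
    · rintro ⟨h1, h2⟩
      refine ⟨Q.src, ?_⟩
      cases Q; simp only at h1 h2; subst h1; subst h2; rfl
    · rintro ⟨z, rfl⟩; exact ⟨rfl, rfl⟩
  have hinj : Set.InjOn (fun z : Site P (t + 1) => (⟨z, p.μ, p.ν, p.hμν⟩ : Plaq P (t + 1))) ↑(Finset.univ : Finset (Site P (t + 1))) :=
    fun z _ z' _ h => by simpa using congrArg Plaq.src h
  rw [himg, Finset.sum_image hinj]
  exact tentKernel_col_three hd ht p p.μ p.ν

/-- ★★ **THE KEY LEMMA ON A `d = 3` TORUS FROM THE ONE-LEVEL STEP** (`M^t U := Averaging.iter (blockAvg ℰ) t U`; `m ≤ P.m + P.K`; thresholds `θ_t ≥ 0` for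
`t < m`; constants `C₁, C₂ ≥ 0`).  IF at every level `t < m` and every coarse plaquette `Q`
`dist1((M^{t+1}U)(∂Q)) ≤ (1 + C₁θ_t)·Σ_p 𝐊(Q,p)·dist1((M^tU)(∂p)) + C₂θ_t·Σ_{q ∈ N(Q.src)} dist1((M^tU)(∂q))` (`𝐊` = ✓px12's tent kernel at `z = Q.src`, plane
`(Q.μ,Q.ν)`; `N` = ✓px10's `3^d`-block neighbourhood), THEN for every `t ≤ m`
`√(Σ_p dist1((M^tU)(∂p))²) ≤ √L^t · exp((C₁ + C₂·√(N_row·N_col)∕√L)·Σ_{i<m} θ_i) · √(Σ_p dist1(U(∂p))²)` (`N_row = 3^dL^dd²`, `N_col = 3^dd²`).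
Proof: §1 with `R = L²` (✓`tentKernel_row`), `C = L⁻¹` (`tentKernel_colPlaq_three`), `ε_t = C₂θ_t√(N_rowN_col)` (✓`sqrt_sum_sq_le_of_le_nbhd_sum`).
[cite: Balaban1985Averaging, (19) p.21; Balaban1985RegularSpaces, §1] -/
theorem keyLemma_torus_of_step (hd : P.d = 3) (ℰ : LoopAverage G) {m : ℕ} (hm : m ≤ P.m + P.K) (U : GaugeField P 0 G)
    (θ : ℕ → ℝ) (hθ : ∀ t, t < m → 0 ≤ θ t) {C₁ C₂ : ℝ} (hC₁ : 0 ≤ C₁) (hC₂ : 0 ≤ C₂)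
    (hstep1 : ∀ t, t < m → ∀ Q : Plaq P (t + 1),
      dist1 (GaugeField.plaqHol (Averaging.iter (fun k => blockAvg (P := P) (j := k) ℰ) (t + 1) U) Q) ≤
        (1 + C₁ * θ t) * ∑ p : Plaq P t, ((P.L : ℝ) ^ P.d)⁻¹ * (((block Q.src).filter (fun x : Site P t => p.μ = Q.μ ∧ p.ν = Q.ν ∧
            ∃ a ∈ range P.L, ∃ b ∈ range P.L, p.src = shiftN (shiftN x Q.μ a) Q.ν b)).card : ℝ) *
            dist1 (GaugeField.plaqHol (Averaging.iter (fun k => blockAvg (P := P) (j := k) ℰ) t U) p) +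
          C₂ * θ t * ∑ q ∈ Finset.univ.filter (fun q : Plaq P t => ∀ κ, blockOf q.src κ = Q.src κ ∨ blockOf q.src κ = Q.src κ + 1 ∨
            blockOf q.src κ = Q.src κ - 1), dist1 (GaugeField.plaqHol (Averaging.iter (fun k => blockAvg (P := P) (j := k) ℰ) t U) q)) :
    ∀ t, t ≤ m → √(∑ p : Plaq P t, dist1 (GaugeField.plaqHol (Averaging.iter (fun k => blockAvg (P := P) (j := k) ℰ) t U) p) ^ 2) ≤
      Real.sqrt (P.L : ℝ) ^ t *
          Real.exp ((C₁ + C₂ * √(((3 ^ P.d * P.L ^ P.d * P.d ^ 2 : ℕ) : ℝ) * ((3 ^ P.d * P.d ^ 2 : ℕ) : ℝ)) / Real.sqrt (P.L : ℝ)) *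
            ∑ i ∈ range m, θ i) *
        √(∑ p : Plaq P 0, dist1 (GaugeField.plaqHol U p) ^ 2) := by
  classical
  set av : (k : ℕ) → Averaging P k G := fun k => blockAvg (P := P) (j := k) ℰ with hav
  set Nrc : ℝ := √(((3 ^ P.d * P.L ^ P.d * P.d ^ 2 : ℕ) : ℝ) * ((3 ^ P.d * P.d ^ 2 : ℕ) : ℝ)) with hNrc
  have hNrc0 : 0 ≤ Nrc := Real.sqrt_nonneg _
  have hL0 : (0 : ℝ) < P.L := Nat.cast_pos.mpr P.L_pos
  have hL1 : (1 : ℝ) ≤ P.L := by exact_mod_cast P.L_pos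
  have hlev : ∀ t, t < m → t + 1 ≤ P.m + P.K := fun t ht => by omega
  -- the data of §1
  have h := keyLemma_tower_upto_sqrtL (fun t => Plaq P t) m
    (fun t p => dist1 (GaugeField.plaqHol (Averaging.iter av t U) p)) (fun t p => GaugeGroup.dist1_nonneg _)
    (fun t Q p => ((P.L : ℝ) ^ P.d)⁻¹ * (((block Q.src).filter (fun x : Site P t => p.μ = Q.μ ∧ p.ν = Q.ν ∧
      ∃ a ∈ range P.L, ∃ b ∈ range P.L, p.src = shiftN (shiftN x Q.μ a) Q.ν b)).card : ℝ))
    (fun t _ Q p => tentKernel_nonneg Q.src p Q.μ Q.ν) hL1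
    (fun _ => (P.L : ℝ) ^ 2) (fun _ => (P.L : ℝ)⁻¹) (fun t => C₁ * θ t) (fun t => C₂ * θ t * Nrc)
    (fun t _ => by positivity) (fun t _ => by field_simp)
    (fun t ht Q => (tentKernel_row (hlev t ht) Q.src Q.hμν).le) (fun t ht p => tentKernel_colPlaq_three hd (hlev t ht) p)
    (fun t ht => mul_nonneg hC₁ (hθ t ht)) (fun t ht => mul_nonneg (mul_nonneg hC₂ (hθ t ht)) hNrc0)
    (fun t Q => C₂ * θ t * ∑ q ∈ Finset.univ.filter (fun q : Plaq P t => ∀ κ, blockOf q.src κ = Q.src κ ∨ blockOf q.src κ = Q.src κ + 1 ∨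
      blockOf q.src κ = Q.src κ - 1), dist1 (GaugeField.plaqHol (Averaging.iter av t U) q))
    (fun t ht Q => hstep1 t ht Q)
    (fun t ht => sqrt_sum_sq_le_of_le_nbhd_sum (hlev t ht) _ _ (mul_nonneg hC₂ (hθ t ht))
      (fun Q => mul_nonneg (mul_nonneg hC₂ (hθ t ht)) (Finset.sum_nonneg fun q _ => GaugeGroup.dist1_nonneg _))
      (fun Q => le_rfl))
  intro t ht
  refine (h t ht).trans (le_of_eq ?_)
  -- `M^0 U = U`; the exponent is `(C₁ + C₂·Nrc/√L)·Σθ`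
  have hexp : ∑ i ∈ range m, (C₁ * θ i + C₂ * θ i * Nrc / Real.sqrt (P.L : ℝ)) =
      (C₁ + C₂ * Nrc / Real.sqrt (P.L : ℝ)) * ∑ i ∈ range m, θ i := by
    rw [Finset.mul_sum]
    exact Finset.sum_congr rfl fun i _ => by ring
  rw [hexp]
  rfl

end Torus

/-! ## §3 The T³ record: `hF1` of ✓`relLetter_of_feeders` with an explicit constant -/

section Record

open T4CubeChartGnomonic (SU2)

variable (F : T3Family) {γ b₀ p₀ : ℝ} {J K : ℕ}

/-- ★★★ **F1-DOCK — THE KEY LEMMA ON THE T³ RECORD ⟸ THE ONE-LEVEL (C)-STEP ON THE LEVELS `t < K − J`** (run `K`, unit-scale depth `J ≤ K`, thresholds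
`θBal F.L γ b₀ p₀ (K − t)` of the good-history event, `SU(2)`, the printed small-loop average `ℰp`; `M^tU := Averaging.iter (blockAvg ℰp) t U`).
IF for every `t < K − J` and every coarse plaquette `Q`
`dist1((M^{t+1}U)(∂Q)) ≤ (1 + C₁·θBal(K−t))·Σ_p 𝐊(Q,p)·dist1((M^tU)(∂p)) + C₂·θBal(K−t)·Σ_{q ∈ N(Q.src)} dist1((M^tU)(∂q))`, THEN for every `t ≤ K − J`
`√(Σ_p dist1((M^tU)(∂p))²) ≤ Kc · √(F.L)^t · √(Σ_p dist1(U(∂p))²)` with `Kc := exp((C₁ + C₂·√(N_rowN_col)∕√(F.L))·Σ_{i<K−J} θBal F.L γ b₀ p₀ (K−i))` —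
both sides of `hF1` of ✓px17 g19 `…HFlatOfFeeders.relLetter_of_feeders` VERBATIM. [cite: Balaban1985Averaging, (19) p.21; Balaban1985UV3, (7) p.257] -/
theorem keyLemma_record_of_step (hJK : J ≤ K) (U : GaugeField (F.P K) 0 SU2)
    (hθ : ∀ t, t < K - J → 0 ≤ θBal F.L γ b₀ p₀ (K - t)) {C₁ C₂ : ℝ} (hC₁ : 0 ≤ C₁) (hC₂ : 0 ≤ C₂)
    (hstep1 : ∀ t, t < K - J → ∀ Q : Plaq (F.P K) (t + 1),
      dist1 (GaugeField.plaqHol (Averaging.iter (fun k => blockAvg (P := F.P K) (j := k) ℰp) (t + 1) U) Q) ≤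
        (1 + C₁ * θBal F.L γ b₀ p₀ (K - t)) *
            ∑ p : Plaq (F.P K) t, (((F.P K).L : ℝ) ^ (F.P K).d)⁻¹ *
              (((block Q.src).filter (fun x : Site (F.P K) t => p.μ = Q.μ ∧ p.ν = Q.ν ∧
                ∃ a ∈ range (F.P K).L, ∃ b ∈ range (F.P K).L, p.src = shiftN (shiftN x Q.μ a) Q.ν b)).card : ℝ) *
              dist1 (GaugeField.plaqHol (Averaging.iter (fun k => blockAvg (P := F.P K) (j := k) ℰp) t U) p) +
          C₂ * θBal F.L γ b₀ p₀ (K - t) *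
            ∑ q ∈ Finset.univ.filter (fun q : Plaq (F.P K) t => ∀ κ, blockOf q.src κ = Q.src κ ∨ blockOf q.src κ = Q.src κ + 1 ∨
              blockOf q.src κ = Q.src κ - 1), dist1 (GaugeField.plaqHol (Averaging.iter (fun k => blockAvg (P := F.P K) (j := k) ℰp) t U) q)) :
    ∀ t, t ≤ K - J →
      √(∑ p, dist1 (GaugeField.plaqHol (Averaging.iter (fun k => blockAvg (P := F.P K) (j := k) ℰp) t U) p) ^ 2) ≤
        Real.exp ((C₁ + C₂ * √(((3 ^ (F.P K).d * (F.P K).L ^ (F.P K).d * (F.P K).d ^ 2 : ℕ) : ℝ) *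
              ((3 ^ (F.P K).d * (F.P K).d ^ 2 : ℕ) : ℝ)) / Real.sqrt (F.L : ℝ)) *
            ∑ i ∈ range (K - J), θBal F.L γ b₀ p₀ (K - i)) *
          Real.sqrt (F.L : ℝ) ^ t * √(∑ p, dist1 (GaugeField.plaqHol U p) ^ 2) := by
  have hm : K - J ≤ (F.P K).m + (F.P K).K := by show K - J ≤ F.m + K; omega
  have h := keyLemma_torus_of_step (P := F.P K) (F.P_d K) ℰp hm U (fun t => θBal F.L γ b₀ p₀ (K - t)) hθ hC₁ hC₂ hstep1
  intro t ht
  have h' := h t ht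
  rw [mul_comm (Real.sqrt ((F.P K).L : ℝ) ^ t)] at h'
  exact h'

end Record

/-! ## §4 The uniform constant: `Kc := exp 1` for `γ ≤ γ₁(L, b₀, p₀, C₁, C₂, a₀)` -/

section Uniform

open T4CubeChartGnomonic (SU2)

/-- ★★★ **F1-DOCK, UNIFORM EDITION** (the `∃ C` of ✓px17 `hFlat_of_letter`'s `HL` is chosen before `(b₀, p₀)`; here `Kc := exp 1`).  For every block size
`L > 1`, (C)-STEP constants `C₁, C₂ ≥ 0`, a guard `a₀ > 0` the step's supplier may ask of the thresholds, and every profile `b₀, p₀ > 0`, there is `γ₁ > 0` such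
that for `0 < γ ≤ γ₁`: (i) `0 ≤ θBal L γ b₀ p₀ i ≤ a₀` at every distance `i`; (ii) for every T³ family with `F.L = L`, every `J ≤ K`, every good history
`U ∈ histGood K J` whose levels `t < K − J` obey the (C)-STEP (hypothesis offered WITH its premises `PlaqSmall θBal(K−t) (M^tU)` and `θBal(K−t) ≤ a₀`), and every
`t ≤ K − J`: `√(Σ_p dist1((M^tU)(∂p))²) ≤ exp 1 · √(F.L)^t · √(Σ_p dist1(U(∂p))²)` — `hF1` VERBATIM with `Kc := exp 1`.  By §3 and ✓`thresholdSum_small`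
(`C := C₁ + C₂·√(N_rowN_col)∕√L`, `δ := 1`). [cite: Balaban1985UV3, (3) p.256 and (7) p.257; Balaban1985Averaging, (19) p.21] -/
theorem keyLemma_record_uniform (L : ℕ) (hL : 1 < L) {C₁ C₂ a₀ : ℝ} (hC₁ : 0 ≤ C₁) (hC₂ : 0 ≤ C₂) (ha₀ : 0 < a₀)
    (b₀ p₀ : ℝ) (hb : 0 < b₀) (hp : 0 < p₀) :
    ∃ γ₁ : ℝ, 0 < γ₁ ∧ ∀ γ : ℝ, 0 < γ → γ ≤ γ₁ →
      (∀ i : ℕ, 0 ≤ θBal L γ b₀ p₀ i ∧ θBal L γ b₀ p₀ i ≤ a₀) ∧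
      ∀ (F : T3Family), F.L = L → ∀ (J K : ℕ), J ≤ K → ∀ U : GaugeField (F.P K) 0 SU2,
        U ∈ histGood F ℰp (θBal F.L γ b₀ p₀) K J →
        (∀ t, t < K - J →
          PlaqSmall (θBal F.L γ b₀ p₀ (K - t)) (Averaging.iter (fun k => blockAvg (P := F.P K) (j := k) ℰp) t U) →
          θBal F.L γ b₀ p₀ (K - t) ≤ a₀ →
          ∀ Q : Plaq (F.P K) (t + 1),
            dist1 (GaugeField.plaqHol (Averaging.iter (fun k => blockAvg (P := F.P K) (j := k) ℰp) (t + 1) U) Q) ≤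
              (1 + C₁ * θBal F.L γ b₀ p₀ (K - t)) *
                  ∑ p : Plaq (F.P K) t, (((F.P K).L : ℝ) ^ (F.P K).d)⁻¹ *
                    (((block Q.src).filter (fun x : Site (F.P K) t => p.μ = Q.μ ∧ p.ν = Q.ν ∧
                      ∃ a ∈ range (F.P K).L, ∃ b ∈ range (F.P K).L, p.src = shiftN (shiftN x Q.μ a) Q.ν b)).card : ℝ) *
                    dist1 (GaugeField.plaqHol (Averaging.iter (fun k => blockAvg (P := F.P K) (j := k) ℰp) t U) p) +
                C₂ * θBal F.L γ b₀ p₀ (K - t) *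
                  ∑ q ∈ Finset.univ.filter (fun q : Plaq (F.P K) t => ∀ κ, blockOf q.src κ = Q.src κ ∨ blockOf q.src κ = Q.src κ + 1 ∨
                    blockOf q.src κ = Q.src κ - 1),
                    dist1 (GaugeField.plaqHol (Averaging.iter (fun k => blockAvg (P := F.P K) (j := k) ℰp) t U) q)) →
        ∀ t, t ≤ K - J →
          √(∑ p, dist1 (GaugeField.plaqHol (Averaging.iter (fun k => blockAvg (P := F.P K) (j := k) ℰp) t U) p) ^ 2) ≤
            Real.exp 1 * Real.sqrt (F.L : ℝ) ^ t * √(∑ p, dist1 (GaugeField.plaqHol U p) ^ 2) := by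
  -- the `L`-only constant of the exponent
  set Cn : ℝ := C₁ + C₂ * √(((3 ^ 3 * L ^ 3 * 3 ^ 2 : ℕ) : ℝ) * ((3 ^ 3 * 3 ^ 2 : ℕ) : ℝ)) / Real.sqrt (L : ℝ) with hCn
  have hCn0 : 0 ≤ Cn := by positivity
  obtain ⟨γ₁, hγ₁, H⟩ := thresholdSum_small L hL b₀ p₀ hb hp Cn a₀ 1 hCn0 ha₀ one_pos
  refine ⟨γ₁, hγ₁, fun γ hγ hγle => ⟨(H γ hγ hγle).1, ?_⟩⟩
  intro F hFL J K hJK U hU hstep t ht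
  have hθ : ∀ t, t < K - J → 0 ≤ θBal F.L γ b₀ p₀ (K - t) := fun t _ => by rw [hFL]; exact ((H γ hγ hγle).1 _).1
  -- the step on the levels of the good history
  have hstep1 := fun t (htl : t < K - J) (Q : Plaq (F.P K) (t + 1)) =>
    hstep t htl (hU t (by omega)) (by rw [hFL]; exact ((H γ hγ hγle).1 _).2) Q
  have h := keyLemma_record_of_step F hJK U hθ hC₁ hC₂ hstep1 t ht
  refine h.trans (mul_le_mul_of_nonneg_right (mul_le_mul_of_nonneg_right (Real.exp_le_exp.mpr ?_) (pow_nonneg (Real.sqrt_nonneg _) _))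
    (Real.sqrt_nonneg _))
  -- the exponent is `Cn · Σθ ≤ 1`
  have hsum := (H γ hγ hγle).2 J K hJK
  have hd : (F.P K).d = 3 := F.P_d K
  have hPL : (F.P K).L = F.L := rfl
  rw [hd, hPL, hFL]
  exact hsum

end Uniform

end Summit.QuantumFields.YangMills.Theorems.FluctuationComparisonRegPrIntLS2BetaKeyLemmaRecord

end
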